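import Mathlib
import HarnessLib
import Literature.MathematicalPhysics.QuantumLattice.CloverPseudoscalarParity
import Summits.Ventures.LatticeQCDFlow.Scoring.WilsonFlowRK3Consistency

/-!
# Explicit bounds on the clover densities: `‖C_{μν}(x)‖ ≤ √N`, `0 ≤ S_x ≤ 6N`, `|P_x| ≤ 6N`, `|Q| ≤ 6N·L⁴` for every unitary representation of dimension `N` — numbers an engine can assert on every measurement

HONEST FRAMING: exact (Metropolis-corrected) sampling algorithms for lattice gauge theory;
figures of merit are autocorrelation/cost numbers at stated couplings and volumes; no
continuum-physics claim.

Venture `LatticeQCDFlow` (cell pub-lqcd), sub-topic `Scoring`, FANOUT row 21 (`su3-base`).  The row's two scored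
observables are the clover topological charge density `P_x` and the clover energy density `S_x` (`t²E`), read on
RK3-flowed `SU(3)` fields (HOME/su3-base/CARD-su3-base.md §3).  The Literature records their boundedness only
EXISTENTIALLY (`CloverObservables.exists_abs_cloverPseudoscalar_le`, by compactness of the group) together with the
self-duality inequality `|P_x| ≤ S_x` (`CloverPseudoscalarParity.abs_cloverPseudoscalar_le_flowedCloverEnergy`).  This file
makes the bound a NUMBER — OUR WORK over the Literature's definitions (`flowedClover`, `cloverLeafSum`, `lieProjection`,
the real Hilbert–Schmidt structure `frobeniusInnerProductSpace`, used proof-locally) and Mathlib; no definition, nothing cited as a fact: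

* `norm_cloverLeafSum_le` — every clover LEAF is a product of four unitary link matrices, of Frobenius norm `√N`
  (`‖U‖² = Re tr(U†U) = N`), so `‖Q_{μν}(x)‖ ≤ 4√N`;
* **`norm_flowedClover_zero_le`** — `‖C_{μν}(x)‖ ≤ √N`: the clover is the orthogonal projection `π_𝔤` (a contraction,
  Mathlib `Submodule.norm_starProjection_apply_le`) of a quarter of the four-leaf sum;
* **`flowedCloverEnergy_zero_le`** — `S_x = Σ_{μ<ν} ‖C_{μν}(x)‖² ≤ 6N` in four dimensions (six planes); **`abs_cloverPseudoscalar_le`** — `|P_x| ≤ 6N`; **`abs_sum_cloverPseudoscalar_le`** —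
  `|Σ_{x∈s} P_x| ≤ 6N · #s` for any finite set of sites (`abs_sum_cloverPseudoscalar_le_card`: slabs, sub-volumes),
  `|Σ_x P_x| ≤ 6N · #sites`, i.e. `≤ 6N·L⁴` on the torus (`abs_cloverCharge_torus_le`), and `≤ 6N·L³` for a time slab
  (`card_timeSlab`, `abs_slabCharge_torus_le`);
* the engine's instance (`SU(n)`, fundamental representation, ANY configuration — in particular an RK3-flowed one):
  `su_abs_cloverCharge_le` — every measured charge satisfies `|Q| ≤ 6n·L⁴` — and `su_flowedCloverEnergy_zero_mem_Icc` —
  every measured site energy lies in `[0, 6n]` (`[0, 18]` for `SU(3)`; the lower end is row 16's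
  `WilsonFlowRK3Consistency.flowedCloverEnergy_nonneg`): assertion-grade invariants for the measurement code, independent
  of `β`, `ε`, `m`;
  and a floor for the scale setting: `t²E = 3/10` with `E ≤ 6n` forces `t² ≥ 1/(20n)` (`flowScale_sq_floor`; `t₀ ≥ 0.129`
  lattice units for `SU(3)`).
NOT CLAIMED: sharpness (the true maxima are smaller); anything statistical.
-/

noncomputable section

open scoped Matrix.Norms.Frobenius
open Matrix

namespace Summit.Ventures.LatticeQCDFlow.Scoring

open Literature.MathematicalPhysics.QuantumLattice

/-! ## §1 The clover: `‖C_{μν}(x)‖ ≤ √N` -/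

section Clover

variable {d N : ℕ} {R : Type*} [AddGroup R] [One R] {G : Type*} [Group G]
  (ρ : G →* Matrix (Fin N) (Fin N) ℂ)

/-- Each of the four leaves of `Q_{μν}(x)` is a product of unitary matrices, so the four-leaf sum of a unitary link
field has Frobenius norm at most `4√N`. -/
theorem norm_cloverLeafSum_le {V : MatrixLinkField d R N} (hV : ∀ e, V e ∈ Matrix.unitaryGroup (Fin N) ℂ)
    (x : Fin d → R) (μ ν : Fin d) : ‖cloverLeafSum V x μ ν‖ ≤ 4 * Real.sqrt N := by
  -- `‖A‖² = Re tr(A†A) = Re tr 1 = N` for unitary `A` (the Literature's `QuantumFieldTheory.norm_of_mem_unitaryGroup`,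
  -- re-derived inline to keep the imports light)
  have hu : ∀ {A : Matrix (Fin N) (Fin N) ℂ}, A ∈ Matrix.unitaryGroup (Fin N) ℂ → ‖A‖ = Real.sqrt N := by
    intro A hA
    have h1 : Aᴴ * A = 1 := by
      simpa only [Matrix.star_eq_conjTranspose] using Matrix.mem_unitaryGroup_iff'.1 hA
    have h2 : ‖A‖ ^ 2 = N := by
      rw [Matrix.frobenius_norm_sq_eq_re_trace, h1, Matrix.trace_one, Fintype.card_fin]
      simp
    rw [← Real.sqrt_sq (norm_nonneg A), h2]
  have hm : ∀ {A B : Matrix (Fin N) (Fin N) ℂ}, A ∈ Matrix.unitaryGroup (Fin N) ℂ →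
      B ∈ Matrix.unitaryGroup (Fin N) ℂ → A * B ∈ Matrix.unitaryGroup (Fin N) ℂ :=
    fun hA hB => Submonoid.mul_mem _ hA hB
  have hc : ∀ {A : Matrix (Fin N) (Fin N) ℂ}, A ∈ Matrix.unitaryGroup (Fin N) ℂ →
      Aᴴ ∈ Matrix.unitaryGroup (Fin N) ℂ := fun hA => by
    simpa only [Matrix.star_eq_conjTranspose] using Unitary.star_mem hA
  -- the four leaves
  have l1 : ‖V (x, μ) * V (x + Pi.single μ 1, ν) * (V (x + Pi.single ν 1, μ))ᴴ * (V (x, ν))ᴴ‖ = Real.sqrt N :=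
    hu (hm (hm (hm (hV _) (hV _)) (hc (hV _))) (hc (hV _)))
  have l2 : ‖V (x, ν) * (V (x - Pi.single μ 1 + Pi.single ν 1, μ))ᴴ * (V (x - Pi.single μ 1, ν))ᴴ *
      V (x - Pi.single μ 1, μ)‖ = Real.sqrt N :=
    hu (hm (hm (hm (hV _) (hc (hV _))) (hc (hV _))) (hV _))
  have l3 : ‖(V (x - Pi.single μ 1, μ))ᴴ * (V (x - Pi.single μ 1 - Pi.single ν 1, ν))ᴴ *
      V (x - Pi.single μ 1 - Pi.single ν 1, μ) * V (x - Pi.single ν 1, ν)‖ = Real.sqrt N :=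
    hu (hm (hm (hm (hc (hV _)) (hc (hV _))) (hV _)) (hV _))
  have l4 : ‖(V (x - Pi.single ν 1, ν))ᴴ * V (x - Pi.single ν 1, μ) * V (x - Pi.single ν 1 + Pi.single μ 1, ν) *
      (V (x, μ))ᴴ‖ = Real.sqrt N :=
    hu (hm (hm (hm (hc (hV _)) (hV _)) (hV _)) (hc (hV _)))
  unfold cloverLeafSum
  calc _ ≤ ‖V (x, μ) * V (x + Pi.single μ 1, ν) * (V (x + Pi.single ν 1, μ))ᴴ * (V (x, ν))ᴴ +
          V (x, ν) * (V (x - Pi.single μ 1 + Pi.single ν 1, μ))ᴴ * (V (x - Pi.single μ 1, ν))ᴴ *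
            V (x - Pi.single μ 1, μ) +
          (V (x - Pi.single μ 1, μ))ᴴ * (V (x - Pi.single μ 1 - Pi.single ν 1, ν))ᴴ *
            V (x - Pi.single μ 1 - Pi.single ν 1, μ) * V (x - Pi.single ν 1, ν)‖ +
        ‖(V (x - Pi.single ν 1, ν))ᴴ * V (x - Pi.single ν 1, μ) * V (x - Pi.single ν 1 + Pi.single μ 1, ν) *
          (V (x, μ))ᴴ‖ := norm_add_le _ _
    _ ≤ (‖V (x, μ) * V (x + Pi.single μ 1, ν) * (V (x + Pi.single ν 1, μ))ᴴ * (V (x, ν))ᴴ +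
          V (x, ν) * (V (x - Pi.single μ 1 + Pi.single ν 1, μ))ᴴ * (V (x - Pi.single μ 1, ν))ᴴ *
            V (x - Pi.single μ 1, μ)‖ +
          ‖(V (x - Pi.single μ 1, μ))ᴴ * (V (x - Pi.single μ 1 - Pi.single ν 1, ν))ᴴ *
            V (x - Pi.single μ 1 - Pi.single ν 1, μ) * V (x - Pi.single ν 1, ν)‖) +
        ‖(V (x - Pi.single ν 1, ν))ᴴ * V (x - Pi.single ν 1, μ) * V (x - Pi.single ν 1 + Pi.single μ 1, ν) *
          (V (x, μ))ᴴ‖ := by gcongr; exact norm_add_le _ _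
    _ ≤ ((‖V (x, μ) * V (x + Pi.single μ 1, ν) * (V (x + Pi.single ν 1, μ))ᴴ * (V (x, ν))ᴴ‖ +
          ‖V (x, ν) * (V (x - Pi.single μ 1 + Pi.single ν 1, μ))ᴴ * (V (x - Pi.single μ 1, ν))ᴴ *
            V (x - Pi.single μ 1, μ)‖) +
          ‖(V (x - Pi.single μ 1, μ))ᴴ * (V (x - Pi.single μ 1 - Pi.single ν 1, ν))ᴴ *
            V (x - Pi.single μ 1 - Pi.single ν 1, μ) * V (x - Pi.single ν 1, ν)‖) +
        ‖(V (x - Pi.single ν 1, ν))ᴴ * V (x - Pi.single ν 1, μ) * V (x - Pi.single ν 1 + Pi.single μ 1, ν) *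
          (V (x, μ))ᴴ‖ := by gcongr; exact norm_add_le _ _
    _ = 4 * Real.sqrt N := by rw [l1, l2, l3, l4]; ring

/-- **`‖C_{μν}(x)‖ ≤ √N`** for the bare clover of a unitary representation of dimension `N`: `π_𝔤` is an orthogonal
projection (a contraction) and `‖¼ Q_{μν}(x)‖ ≤ √N`. -/
theorem norm_flowedClover_zero_le (hρ : ∀ g, ρ g ∈ Matrix.unitaryGroup (Fin N) ℂ)
    (U : (Fin d → R) × Fin d → G) (x : Fin d → R) (μ ν : Fin d) :
    ‖flowedClover ρ 0 U x μ ν‖ ≤ Real.sqrt N := by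
  -- the real Hilbert–Schmidt structure under which `π_𝔤` is an orthogonal projection (proof-local, as in the Literature)
  letI : InnerProductSpace ℝ (Matrix (Fin N) (Fin N) ℂ) :=
    Literature.MathematicalPhysics.QuantumLattice.frobeniusInnerProductSpace
  rw [flowedClover_zero]
  unfold lieProjection
  refine (Submodule.norm_starProjection_apply_le _ _).trans ?_
  rw [norm_smul, Real.norm_of_nonneg (by norm_num : (0 : ℝ) ≤ 1 / 4)]
  have h := norm_cloverLeafSum_le (V := fun e => ρ (U e)) (fun e => hρ (U e)) x μ ν
  linarith

/-- `‖C_{μν}(x)‖² = Re tr(C† C) ≤ N`. -/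
theorem re_trace_conjTranspose_mul_flowedClover_zero_le (hρ : ∀ g, ρ g ∈ Matrix.unitaryGroup (Fin N) ℂ)
    (U : (Fin d → R) × Fin d → G) (x : Fin d → R) (μ ν : Fin d) :
    ((flowedClover ρ 0 U x μ ν)ᴴ * flowedClover ρ 0 U x μ ν).trace.re ≤ N := by
  have h1 : ((flowedClover ρ 0 U x μ ν)ᴴ * flowedClover ρ 0 U x μ ν).trace.re = ‖flowedClover ρ 0 U x μ ν‖ ^ 2 := by
    rw [Matrix.frobenius_norm_sq_eq_re_trace, RCLike.re_to_complex]
  rw [h1]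
  have h := norm_flowedClover_zero_le ρ hρ U x μ ν
  have h0 : 0 ≤ ‖flowedClover ρ 0 U x μ ν‖ := norm_nonneg _
  calc ‖flowedClover ρ 0 U x μ ν‖ ^ 2 ≤ (Real.sqrt N) ^ 2 := by gcongr
    _ = (N : ℝ) := Real.sq_sqrt (Nat.cast_nonneg N)

end Clover

/-! ## §2 Four dimensions: `S_x ≤ 6N`, `|P_x| ≤ 6N`, `|Q| ≤ 6N · #sites` -/

section Four

variable {N : ℕ} {R : Type*} [AddGroup R] [One R] {G : Type*} [Group G]
  (ρ : G →* Matrix (Fin N) (Fin N) ℂ)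

/-- **`S_x ≤ 6N`**: the bare clover energy density of a unitary representation of dimension `N` in four dimensions
(six planes, each `‖C_{μν}‖² ≤ N`). -/
theorem flowedCloverEnergy_zero_le (hρ : ∀ g, ρ g ∈ Matrix.unitaryGroup (Fin N) ℂ)
    (x : Fin 4 → R) (U : (Fin 4 → R) × Fin 4 → G) : flowedCloverEnergy ρ 0 x U ≤ 6 * N := by
  unfold flowedCloverEnergy
  have hb : ∀ μ ν : Fin 4, (if μ < ν then ((flowedClover ρ 0 U x μ ν)ᴴ * flowedClover ρ 0 U x μ ν).trace.re else 0)
      ≤ if μ < ν then (N : ℝ) else 0 := by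
    intro μ ν
    split_ifs
    · exact re_trace_conjTranspose_mul_flowedClover_zero_le ρ hρ U x μ ν
    · exact le_rfl
  calc _ ≤ ∑ μ : Fin 4, ∑ ν : Fin 4, (if μ < ν then (N : ℝ) else 0) :=
        Finset.sum_le_sum fun μ _ => Finset.sum_le_sum fun ν _ => hb μ ν
    _ = 6 * N := by
        simp only [Fin.sum_univ_four, Fin.isValue]
        simp (config := { decide := true }) only [if_true, if_false]
        ring

/-- **`|P_x| ≤ 6N`**: the bare clover pseudoscalar density of a unitary representation of dimension `N`
(`|P_x| ≤ S_x ≤ 6N`). -/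
theorem abs_cloverPseudoscalar_le (hρ : ∀ g, ρ g ∈ Matrix.unitaryGroup (Fin N) ℂ)
    (x : Fin 4 → R) (U : (Fin 4 → R) × Fin 4 → G) : |cloverPseudoscalar ρ x U| ≤ 6 * N :=
  (abs_cloverPseudoscalar_le_flowedCloverEnergy ρ x U).trans (flowedCloverEnergy_zero_le ρ hρ x U)

/-- **`|Σ_{x ∈ s} P_x| ≤ 6N · #s`** for any finite set of sites `s` (a time slab, a sub-volume, the whole torus). -/
theorem abs_sum_cloverPseudoscalar_le_card (hρ : ∀ g, ρ g ∈ Matrix.unitaryGroup (Fin N) ℂ)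
    (U : (Fin 4 → R) × Fin 4 → G) (s : Finset (Fin 4 → R)) :
    |∑ x ∈ s, cloverPseudoscalar ρ x U| ≤ 6 * N * s.card := by
  calc |∑ x ∈ s, cloverPseudoscalar ρ x U| ≤ ∑ x ∈ s, |cloverPseudoscalar ρ x U| :=
        Finset.abs_sum_le_sum_abs _ _
    _ ≤ ∑ _x ∈ s, (6 * N : ℝ) := Finset.sum_le_sum fun x _ => abs_cloverPseudoscalar_le ρ hρ x U
    _ = 6 * N * s.card := by rw [Finset.sum_const, nsmul_eq_mul]; ring

/-- **`|Σ_x P_x| ≤ 6N · #sites`** on any finite site set. -/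
theorem abs_sum_cloverPseudoscalar_le [Fintype R] (hρ : ∀ g, ρ g ∈ Matrix.unitaryGroup (Fin N) ℂ)
    (U : (Fin 4 → R) × Fin 4 → G) :
    |∑ x : Fin 4 → R, cloverPseudoscalar ρ x U| ≤ 6 * N * Fintype.card (Fin 4 → R) := by
  rw [← Finset.card_univ]
  exact abs_sum_cloverPseudoscalar_le_card ρ hρ U Finset.univ

/-- **On the torus `(ℤ/L)⁴`: `|Q| ≤ 6N·L⁴`.** -/
theorem abs_cloverCharge_torus_le {L : ℕ} [NeZero L] (hρ : ∀ g, ρ g ∈ Matrix.unitaryGroup (Fin N) ℂ)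
    (U : (Fin 4 → ZMod L) × Fin 4 → G) :
    |∑ x : Fin 4 → ZMod L, cloverPseudoscalar ρ x U| ≤ 6 * N * (L : ℝ) ^ 4 := by
  have h := abs_sum_cloverPseudoscalar_le ρ hρ U
  rwa [Fintype.card_fun, ZMod.card, Fintype.card_fin, Nat.cast_pow] at h

/-- A time slab of the four-torus has `L³` sites. -/
theorem card_timeSlab {L : ℕ} [NeZero L] (t : ZMod L) :
    (Finset.univ.filter fun x : Fin 4 → ZMod L => x 0 = t).card = L ^ 3 := by
  let e : {x : Fin 4 → ZMod L // x 0 = t} ≃ (Fin 3 → ZMod L) :=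
    { toFun := fun x => Fin.tail x.1
      invFun := fun y => ⟨Fin.cons t y, by simp⟩
      left_inv := fun x => by
        rcases x with ⟨x, hx⟩
        simp only [Subtype.mk.injEq]
        rw [← hx, Fin.cons_self_tail]
      right_inv := fun y => by funext i; simp [Fin.tail] }
  rw [← Fintype.card_subtype, Fintype.card_congr e, Fintype.card_fun, ZMod.card, Fintype.card_fin]

/-- **On the torus: every slab charge satisfies `|Σ_{x₀ = t} P_x| ≤ 6N·L³`.** -/
theorem abs_slabCharge_torus_le {L : ℕ} [NeZero L] (hρ : ∀ g, ρ g ∈ Matrix.unitaryGroup (Fin N) ℂ)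
    (U : (Fin 4 → ZMod L) × Fin 4 → G) (t : ZMod L) :
    |∑ x ∈ Finset.univ.filter (fun x : Fin 4 → ZMod L => x 0 = t), cloverPseudoscalar ρ x U| ≤
      6 * N * (L : ℝ) ^ 3 := by
  have h := abs_sum_cloverPseudoscalar_le_card ρ hρ U (Finset.univ.filter fun x : Fin 4 → ZMod L => x 0 = t)
  rwa [card_timeSlab, Nat.cast_pow] at h

end Four

/-! ## §3 The engine's instance: `SU(n)`, fundamental representation, any (e.g. RK3-flowed) configuration -/

section Engine

variable {L n : ℕ} [NeZero L]

omit [NeZero L] in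
/-- **Every measured site energy lies in `[0, 6n]`** (`SU(n)` fundamental representation; `[0, 18]` for `SU(3)`), for
every configuration the engine can hold — in particular for `RK3_{ε}^m U` at every `β`, `ε`, `m`. -/
theorem su_flowedCloverEnergy_zero_mem_Icc (x : Fin 4 → ZMod L)
    (V : (Fin 4 → ZMod L) × Fin 4 → Matrix.specialUnitaryGroup (Fin n) ℂ) :
    flowedCloverEnergy (fundamentalRep (Fin n)) 0 x V ∈ Set.Icc (0 : ℝ) (6 * n) :=
  ⟨flowedCloverEnergy_nonneg _ 0 x V,
   flowedCloverEnergy_zero_le _ fundamentalRep_mem_unitaryGroup x V⟩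

/-- **Every measured charge satisfies `|Q| ≤ 6n·L⁴`** (`SU(n)` fundamental representation on the `L⁴` torus; `18·L⁴`
for `SU(3)`), for every configuration — in particular for the RK3-flowed field at every `β`, `ε`, `m`. -/
theorem su_abs_cloverCharge_le (V : (Fin 4 → ZMod L) × Fin 4 → Matrix.specialUnitaryGroup (Fin n) ℂ) :
    |∑ x : Fin 4 → ZMod L, cloverPseudoscalar (fundamentalRep (Fin n)) x V| ≤ 6 * n * (L : ℝ) ^ 4 :=
  abs_cloverCharge_torus_le _ fundamentalRep_mem_unitaryGroup V

/-- **A floor for the reference scale.**  If an energy reading obeys `E ≤ 6n` (as every site energy, hence every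
volume average and every expectation of them does) and solves the scale equation `t²·E = 3/10`, then `t² ≥ 1/(20n)` —
for `SU(3)`: `t₀² ≥ 1/60`, i.e. no crossing of `t²⟨E⟩ = 0.3` can occur below `t = 0.129` in lattice units (a safe start
for the card's `t₀` scan; pure arithmetic from the bound). -/
theorem flowScale_sq_floor {t E : ℝ} (hn : 0 < n) (hE : E ≤ 6 * n) (h : t ^ 2 * E = 3 / 10) :
    1 / (20 * n) ≤ t ^ 2 := by
  have hn' : (0 : ℝ) < n := Nat.cast_pos.2 hn
  have hEpos : 0 < E := by
    by_contra hle
    have : t ^ 2 * E ≤ 0 := mul_nonpos_of_nonneg_of_nonpos (sq_nonneg t) (not_lt.1 hle)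
    linarith
  rw [div_le_iff₀ (by positivity)]
  nlinarith [sq_nonneg t]

end Engine

end Summit.Ventures.LatticeQCDFlow.Scoring
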